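import Literature.NumberTheory.EllipticCurves.HeegnerEnvelopeUniversalNormProofs
import Literature.NumberTheory.EllipticCurves.HeegnerEnvelopeReverseCoherentProofs
import Literature.NumberTheory.EllipticCurves.HeegnerGeomCoherentFamilyIdentityProofs
import Literature.NumberTheory.EllipticCurves.HeegnerGeomStabilizedPointIdentitiesProofs
import HarnessLib

/-!
# The COHERENT PAIR `(C₀, F₀)` on a principal CM system with its point identities, and the module-level
# Heegner envelope `ℋ_∞(F₀) ≤ Λκ_∞(C₀)`, `ω_δ · Λκ_∞(C₀) ≤ ℋ_∞(F₀)` (CGLS 2022 Rem. 4.1.4; proofs file)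

Topic `NumberTheory/EllipticCurves`. THEOREMS ONLY (no definition, no named fact, no `sorry`). Written by the cell
`bsd-print-x9` seat `bsd-line-x9-p2` as the ASSEMBLY of the envelope for the module-level stub of the deciding
crux `PrintX9.HowardContainmentLightFramePinnedOfPrintSharp` (stmt-BirchSwinnertonDyer-27077; twin on X10b):
* the constructors of seat x9-p1 (`exists_principalSystem`, `exists_heegnerFamily_of_system`,
  `exists_stabilizedHeegnerData_of_system` — `HeegnerGeomCoherentDataProofs`) build Howard's family `F₀` and
  CGLS's `d(k)`-shifted datum `C₀` on ONE principal system of Heegner points, both on the given `(Dt, β)`;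
* the point identities of seats x9-p1-w2 / x9-p1 (`HeegnerGeomStabilizedPointIdentitiesProofs` (P1′)(P1″)(P2′),
  `HeegnerGeomCoherentFamilyIdentityProofs` (P3)) hold for `(C₀, F₀)` at the minimal shifts, with an integer
  Lucas pair and the jumps `n_j = d(j+1) − 1 − d(j)` (no pin on `d`, only `K_k ⊆ K[p^{k+1}]`);
* the Kummer/Λ-adic consumers of this seat (`heegnerModule_le_stabilizedHeegnerModule_of_coherent`,
  `exists_ne_zero_smul_stabilizedHeegnerModule_le_heegnerModule_of_coherent`) turn them into the two module
  inclusions.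

WHAT.
* §1 `exists_int_lucas_pair` — integer Lucas pairs exist.
* §2 `exists_coherent_pair_identities` — `∃ C F A B ns` on `(Dt, β)` with (P1′)/(P1″)/(P2′)/(P3) (the last
  with a unit leading coefficient mod `p`).
* §3 **`exists_coherent_pair_envelope`** — `∃ C F` on `(Dt, β)` with `ℋ_∞(F) ≤ Λκ_∞(C)` and
  `∃ g ≠ 0, g • Λκ_∞(C) ≤ ℋ_∞(F)`, under: `K` imaginary quadratic with (Heeg) for `N = N_E`, `4N ∣ β² − d_K`,
  `p ∤ N` good ORDINARY, `#Gal(K[p]/K[1]) = p − 1`, `K_k ⊆ K[p^{k+1}]` for all `k`, `γ` a topological generator,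
  `E(K)[p] = 0`.
HONEST FRAMING: assembly of printed distribution relations and module bookkeeping; nothing about any particular
curve; BSD is not proved by any of this.

References: [CastellaGrossiLeeSkinner2022] Thm. 4.1.1 proof, Rem. 4.1.4 (arXiv:2008.02571v2 TeX L2213–2294);
[Howard2004HeegnerKolyvagin] §3.3, Thm. 3.3.7; [PerrinRiou1987BSMF] §3.3–3.4; [Cox2013] Thm. 7.24.
-/

set_option autoImplicit false

noncomputable section

open scoped Classical Pointwise

open WeierstrassCurve Literature.NumberTheory.EllipticCurves
  Literature.NumberTheory.EllipticCurves.CastellaGrossiLeeSkinner2022 ModularForms RingClassField PowerSeries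

universe u

namespace Literature.NumberTheory.EllipticCurves

/-! ## §1 Integer Lucas pairs -/

/-- Integer solutions of `X_{n+2} = a X_{n+1} − q X_n` with prescribed `X₀, X₁` exist (recursion on pairs).
[cite: CastellaGrossiLeeSkinner2022, Rem. 4.1.4 (the α-stabilised recurrences)] -/
theorem exists_int_lucas_seq (a q x₀ x₁ : ℤ) :
    ∃ X : ℕ → ℤ, X 0 = x₀ ∧ X 1 = x₁ ∧ ∀ n, X (n + 2) = a * X (n + 1) - q * X n := by
  let f : ℕ → ℤ × ℤ := fun n ↦ Nat.rec (x₀, x₁) (fun _ ih ↦ (ih.2, a * ih.2 - q * ih.1)) n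
  refine ⟨fun n ↦ (f n).1, rfl, rfl, fun n ↦ ?_⟩
  show (f (n + 2)).1 = a * (f (n + 1)).1 - q * (f n).1
  rfl

/-! ## §2 The coherent pair and its identities -/

section Pair

variable {K : Type} [Field K] [NumberField K] {W : WeierstrassCurve ℚ} [W.IsElliptic] [W.IsGloballyMinimal]
  [NeZero (W.conductorNorm ℤ)] {p : ℕ} [Fact p.Prime]

/-- **The coherent pair with its point identities.** For `K` imaginary quadratic with the Heegner hypothesis
for `N = N_E`, an orientation `β`, a parametrisation datum `Dt`, a prime `p ∤ N` with `p ∤ a_p`, a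
`ℤ_p`-extension `κ` with `K_k ⊆ K[p^{k+1}]` for all `k` and `#Gal(K[p]/K[1]) = p − 1`, and a topological
generator `γ`: there are a CGLS datum `C` and a Howard family `F`, both on `(Dt, β)`, an integer Lucas pair
`(A, B)` and jumps `ns` such that, above the torsion depth `δ`, (P1′) `v_{j+1} = A_{ns j} • u_j + B_{ns j} • v_j`,
(P1″) `v_{j+1}` is `K_j`-rational (all `j ≥ δ`), (P2′) `Σ_{i<p} γ^{p^j i} • u_{j+1} = A_{ns j+1} • u_j + B_{ns j+1} • v_j`,
(P3) `z_j = a • u_j + b • v_j` with `p ∤ a`.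
[cite: CastellaGrossiLeeSkinner2022, Thm. 4.1.1 proof (P_k[n], d(k)) and Rem. 4.1.4] [cite: Howard2004HeegnerKolyvagin, §3.3]
[cite: PerrinRiou1987BSMF, §3.3 (relations de distribution)] -/
theorem exists_coherent_pair_identities (hK : IsImaginaryQuadratic K)
    (hH : SatisfiesHeegnerHypothesis (W.conductorNorm ℤ) K) (Dt : ModularParametrizationData W (W.conductorNorm ℤ))
    {β : ℤ} (hβ : (4 * (W.conductorNorm ℤ : ℕ) : ℤ) ∣ β ^ 2 - NumberField.discr K)
    (jbar : AlgebraicClosure K →+* ℂ) (hpN : ¬ p ∣ W.conductorNorm ℤ) (hap : ¬ (p : ℤ) ∣ W.frobeniusTrace p)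
    (κ : ZpExtension K p) {γ : Field.absoluteGaloisGroup K} (hγ : κ.IsTopGenerator γ)
    (hTw1 : ∀ k, ringClassSubgroup K (p ^ (k + 1)) jbar ≤ κ.layerSubgroup k)
    (hcardp : Nat.card (ringClassGalOver (jbar.comp (algebraMap K (AlgebraicClosure K))) p 1) = p - 1) :
    ∃ (C : StabilizedHeegnerData (W.conductorNorm ℤ) W K κ jbar) (F : HeegnerFamily (W.conductorNorm ℤ) W K κ jbar)
      (A B : ℕ → ℤ) (ns : ℕ → ℕ),
      C.Dt = Dt ∧ F.Dt = Dt ∧ C.β = β ∧ F.β = β ∧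
      (A 0 = 1 ∧ A 1 = W.frobeniusTrace p ∧ ∀ m, A (m + 2) = W.frobeniusTrace p * A (m + 1) - p * A m) ∧
      (B 0 = 0 ∧ B 1 = -1 ∧ ∀ m, B (m + 2) = W.frobeniusTrace p * B (m + 1) - p * B m) ∧
      (∀ j, C.depth < j → C.v (j + 1) = A (ns j) • C.u j + B (ns j) • C.v j) ∧
      (∀ j, C.depth ≤ j → ∀ σ ∈ κ.layerSubgroup j, σ • C.v (j + 1) = C.v (j + 1)) ∧
      (∀ j, C.depth < j →
        ∑ i ∈ Finset.range p, (γ ^ (p ^ j * i)) • C.u (j + 1) = A (ns j + 1) • C.u j + B (ns j + 1) • C.v j) ∧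
      (∀ j, C.depth < j → ∃ a b : ℤ, ¬ (p : ℤ) ∣ a ∧ F.z j = a • C.u j + b • C.v j) := by
  have hp : p.Prime := Fact.out
  -- the principal system and the two coherent structures on it
  obtain ⟨x, P, hxP⟩ := exists_principalSystem hK hH Dt hβ jbar hp hpN
  have hx : ∀ j, complexPoint W jbar (x j) = heegnerPointComplexOfConductor Dt (NumberField.discr K) β (p ^ j) :=
    fun j ↦ (hxP j).1
  have hP : ∀ j, WeierstrassCurve.Affine.Point.map (W' := W)
      (ringClassField K (jbar.comp (algebraMap K (AlgebraicClosure K))) (p ^ j)).subtype.toRatAlgHom (P j) =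
      heegnerPointComplexOfConductor Dt (NumberField.discr K) β (p ^ j) := fun j ↦ (hxP j).2.1
  have hgeom : ∀ j, IsHeegnerGeomPoint (W.conductorNorm ℤ) W K Dt β (p ^ j) jbar (x j) := fun j ↦ (hxP j).2.2.1
  have hfix : ∀ j, ∀ σ ∈ ringClassSubgroup K (p ^ j) jbar, σ • x j = x j := fun j ↦ (hxP j).2.2.2
  obtain ⟨F, T, R, hFDt, hFβ, -, -, hR, hz⟩ := exists_heegnerFamily_of_system Dt hβ jbar κ hgeom hfix
  obtain ⟨C, Aₜ, hCDt, hCβ, hdle, htwo, hA, hu, hv⟩ :=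
    exists_stabilizedHeegnerData_of_system hK Dt hβ jbar κ hTw1 hcardp hgeom hfix
  -- a Lucas pair
  obtain ⟨A, hA0, hA1, hArec⟩ := exists_int_lucas_seq (W.frobeniusTrace p) p 1 (W.frobeniusTrace p)
  obtain ⟨B, hB0, hB1, hBrec⟩ := exists_int_lucas_seq (W.frobeniusTrace p) p 0 (-1)
  -- shift bookkeeping above the depth
  have hd1 : ∀ j, C.depth ≤ j → 2 ≤ C.d (j + 1) := fun j hj ↦ htwo (j + 1) (by omega)
  have hnot : ∀ j, C.depth ≤ j → ¬ ringClassSubgroup K (p ^ (C.d (j + 1) - 1)) jbar ≤ κ.layerSubgroup (j + 1) :=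
    fun j hj ↦ C.d_min (j + 1) _ (by have := hd1 j hj; omega)
  have hd0 : ∀ j, C.depth < j → 1 ≤ C.d j := fun j hj ↦ le_trans one_le_two (htwo j hj)
  have hd01 : ∀ j, C.depth < j → C.d j ≤ C.d (j + 1) - 1 := by
    intro j hj
    have hpred := ringClassSubgroup_pred_le_layerSubgroup hK jbar κ (hd1 j hj.le) (C.layer_le (j + 1))
      (hnot j hj.le)
    exact not_lt.mp fun h ↦ C.d_min j _ h hpred
  refine ⟨C, F, A, B, fun j ↦ C.d (j + 1) - 1 - C.d j, hCDt, hFDt, hCβ, hFβ, ⟨hA0, hA1, hArec⟩,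
    ⟨hB0, hB1, hBrec⟩, ?_, ?_, ?_, ?_⟩
  · -- (P1′)
    intro j hj
    have h := sum_transversal_smul_pred_eq_lucas_of_layer_succ hK hH Dt hβ jbar hpN hx hP hfix κ A B hA0 hA1
      hArec hB0 hB1 hBrec (k := j) (d₁ := C.d (j + 1)) (d₀ := C.d j) (hd1 j hj.le) (C.layer_le (j + 1))
      (hnot j hj.le) (hA (j + 1)).1 (hA (j + 1)).2 (hd0 j hj) (hd01 j hj) (C.layer_le j)
      (hA j).1 (hA j).2
    rw [hv (j + 1), hu j, hv j]
    exact h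
  · -- (P1″)
    intro j hj σ hσ
    rw [hv (j + 1)]
    exact smul_sum_transversal_smul_pred_eq_of_layer_succ hK jbar hfix κ (hd1 j hj) (C.layer_le (j + 1))
      (hnot j hj) (hA (j + 1)).1 (hA (j + 1)).2 hσ
  · -- (P2′)
    intro j hj
    have h := sum_range_pow_smul_sum_transversal_smul_eq_lucas hK hH Dt hβ jbar hpN hx hP hfix κ A B hA0 hA1
      hArec hB0 hB1 hBrec hγ (k := j) (d₁ := C.d (j + 1)) (d₀ := C.d j) (hd1 j hj.le) (C.layer_le (j + 1))
      (hA (j + 1)).1 (hA (j + 1)).2 (hd0 j hj) (hd01 j hj) (C.layer_le j) (hA j).1 (hA j).2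
    have heq : C.d (j + 1) - C.d j = C.d (j + 1) - 1 - C.d j + 1 := by
      have h01 := hd01 j hj
      have h1 := hd1 j hj.le
      omega
    rw [hu (j + 1), hu j, hv j, ← heq]
    exact h
  · -- (P3)
    intro j hj
    exact HeegnerFamily.exists_z_eq_zsmul_u_add_zsmul_v_of_presentation F C hK hH Dt hβ hpN hap hTw1 hcardp hxP
      hA hu hv hR hz hj

end Pair

/-! ## §3 The module-level envelope for the coherent pair -/

section Envelope

variable {K : Type} [Field K] [NumberField K] {W : WeierstrassCurve ℚ} [W.IsElliptic] [W.IsGloballyMinimal]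
  [NeZero (W.conductorNorm ℤ)] {p : ℕ} [Fact p.Prime]

/-- **THE MODULE-LEVEL HEEGNER ENVELOPE FOR THE COHERENT PAIR.** For `K` imaginary quadratic with the Heegner
hypothesis for `N = N_E`, an orientation `β` (`4N ∣ β² − d_K`), a parametrisation datum `Dt`, a good ORDINARY
prime `p ∤ N`, a `ℤ_p`-extension `κ` with `K_k ⊆ K[p^{k+1}]` for every `k` and `#Gal(K[p]/K[1]) = p − 1`, a
topological generator `γ`, `E(K)[p] = 0`, and any `Λ`-adic Selmer datum `D`: there are a CGLS `d(k)`-shifted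
stabilised datum `C` and a Howard family `F`, BOTH on `(Dt, β)`, with
`ℋ_∞(F) ≤ Λκ_∞(C)` and `g • Λκ_∞(C) ≤ ℋ_∞(F)` for some `g ≠ 0` in `Λ` (`g = ω_δ = (1+T)^{p^δ} − 1`) — the tree
statement of «`κ_∞` and `κ₁^{Hg}` generate the same `Λ`-submodule» (CGLS Rem. 4.1.4) / «`𝐇` is generated by
`κ̃₁`» (Howard Thm. 3.3.7) for the tree's two Heegner structures, at ANY class number.
[cite: CastellaGrossiLeeSkinner2022, Rem. 4.1.4 (arXiv:2008.02571v2 TeX L2278–2294)]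
[cite: Howard2004HeegnerKolyvagin, §3.3 and Thm. 3.3.7] [cite: PerrinRiou1987BSMF, §3.4 Prop. 10] -/
theorem exists_coherent_pair_envelope (hK : IsImaginaryQuadratic K)
    (hH : SatisfiesHeegnerHypothesis (W.conductorNorm ℤ) K) (Dt : ModularParametrizationData W (W.conductorNorm ℤ))
    {β : ℤ} (hβ : (4 * (W.conductorNorm ℤ : ℕ) : ℤ) ∣ β ^ 2 - NumberField.discr K)
    (jbar : AlgebraicClosure K →+* ℂ) (hord : IsOrdinaryAt W p) (hpN : ¬ p ∣ W.conductorNorm ℤ)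
    (κ : ZpExtension K p) {γ : Field.absoluteGaloisGroup K} (hγ : κ.IsTopGenerator γ)
    (hTw1 : ∀ k, ringClassSubgroup K (p ^ (k + 1)) jbar ≤ κ.layerSubgroup k)
    (hcardp : Nat.card (ringClassGalOver (jbar.comp (algebraMap K (AlgebraicClosure K))) p 1) = p - 1)
    (hE : ∀ Q : (W.baseChange K).toAffine.Point, p • Q = 0 → Q = 0)
    (D : (W.baseChange K).LambdaAdicSelmerData κ γ) :
    ∃ (C : StabilizedHeegnerData (W.conductorNorm ℤ) W K κ jbar) (F : HeegnerFamily (W.conductorNorm ℤ) W K κ jbar),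
      C.Dt = Dt ∧ F.Dt = Dt ∧ C.β = β ∧ F.β = β ∧
      heegnerModule D F ≤ stabilizedHeegnerModule D C ∧
      ∃ g : IwasawaAlgebra p, g ≠ 0 ∧ g • stabilizedHeegnerModule D C ≤ heegnerModule D F := by
  obtain ⟨C, F, A, B, ns, hCDt, hFDt, hCβ, hFβ, ⟨hA0, hA1, hArec⟩, ⟨hB0, hB1, hBrec⟩, hv1, hvfix, hnorm, hz⟩ :=
    exists_coherent_pair_identities hK hH Dt hβ jbar hpN hord.2 κ hγ hTw1 hcardp
  refine ⟨C, F, hCDt, hFDt, hCβ, hFβ, ?_, ?_⟩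
  · exact heegnerModule_le_stabilizedHeegnerModule_of_coherent D F C hord hγ hE A B hA0 hA1 hArec hB0 hB1 hBrec
      ns hv1 (fun j hj ↦ hvfix j hj.le) hnorm (fun j hj ↦ by
        obtain ⟨a, b, -, h⟩ := hz j hj
        exact ⟨a, b, h⟩)
  · exact exists_ne_zero_smul_stabilizedHeegnerModule_le_heegnerModule_of_coherent D F C hγ hz
      (fun j hj ↦ ⟨_, _, hv1 j hj⟩) (hvfix C.depth le_rfl)

end Envelope

end Literature.NumberTheory.EllipticCurves

end
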